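import Literature.AlgebraicGeometry.Motives.HodgeStructureExteriorAlgebraSl2Multiplicities
import Literature.Algebra.Lie.LefschetzModuleHyperinvariantDualSide
import HarnessLib

/-!
# The `Λ`-hyperinvariant subspaces of the exterior algebra of a symplectic space: `Hinv(Λ) = w·Hinv(L)` has `2^{g+1}` elements, the
# bottom staircases `⊕_k ⊕_{i ≤ k−j_k} ωⁱ ∧ P^{g−k}`; `Ker Λᵃ`, `Im Λᵇ` in Lefschetz coordinates; the `Λ`-primitive (coprimitive) forms
# are the `ωᵏ ∧ P^{g−k} = ⋀^{g+k}W ∩ Ker L` (André 1996 §1.2; Gohberg–Lancaster–Rodman Lemma 9.5.2 for `Λ`)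

[topic AlgebraicGeometry/Motives]

Layer `Literature/AlgebraicGeometry/Motives` (namespace `Literature.AlgebraicGeometry.Motives.ExteriorLefschetz`), lane `lit-hodgefound` (Track 2
foundations library; prover seat `lit-hodgefound-p34`, generation 46, row g46-#11). THEOREMS ONLY (no definition, no instance, no notation, no named
fact; net debt `0`).  A SEQUEL CARRIER of `HodgeStructureExteriorAlgebraSl2Multiplicities` (§10, §16, §17: the `{L}'`-module `⋀W`; that file has
reached the gate's size cap), reading the seat's `Algebra/Lie/LefschetzModuleHyperinvariantDualSide` (g46-#10: the Weyl operator `w` carries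
`Hinv(L)` onto `Hinv(ᶜΛ)`; the `ᶜΛ`-hyperinvariant subspaces are the bottom staircases; `Ker ᶜΛᵃ`, `Im ᶜΛᵇ` in string coordinates; the
`ᶜΛ`-primitives are the tops of the strings) on the exterior algebra `⋀W` of a symplectic space `(W, ω)` of genus `g ≥ 1` (`hω : IsSymplectic ω g`),
with the dictionary `L = ω ∧ ·`, `ᶜΛ = Λ = lefschetzDual ω g` (`IsSymplectic.dual_eq_lefschetzDual`), `w = weylStar ω g` (`IsSymplectic.weylStar_eq`),
string type `k ↔` primitive `(g−k)`-forms `P^{g−k} = primitive ω g (g − k)` (`primitiveSpace_shiftedDegree_mul_eq_primitive`), weight `m ↔` wedge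
degree `m + g`.

THE MATHEMATICS.  `⋀W = ⊕_{k ≤ g} ⊕_{i ≤ k} ωⁱ ∧ P^{g−k}` (Lefschetz decomposition; the string through a primitive `(g−k)`-form `p` is `p, ω∧p, …,
ωᵏ∧p`).  The `L`-hyperinvariant subspaces are the `2^{g+1}` TOP staircases `⊕_k ⊕_{i ≥ j_k} ωⁱ ∧ P^{g−k}` (§10 of the carrier); by the Weyl
operator `w` (`w L w⁻¹ = −Λ`) **the `Λ`-hyperinvariant subspaces — those stable under every operator commuting with the contraction `Λ` — are the
`2^{g+1}` BOTTOM staircases `⊕_{k ≤ g} ⊕_{i ≤ k−j_k} ωⁱ ∧ P^{g−k}`**, `j` admissible (`j_k ≤ j_{k'} ≤ j_k + (k'−k)` for `k ≤ k' ≤ g`); **`Ker Λᵃ =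
⊕_k ⊕_{i < a} ωⁱ ∧ P^{g−k}`** (`a = 1`: the primitive forms), **`Im Λᵇ = ⊕_k ⊕_{i ≤ k−b} ωⁱ ∧ P^{g−k}`**, and **the `Λ`-primitive forms of type `k`
(for the reversed grading) are `w(P^{g−k}) = ωᵏ ∧ P^{g−k} = ⋀^{g+k}W ∩ Ker L`** — the "coprimitive" forms, tops of the strings.

## References
* [Andre1996Motifs] Y. André, *Pour une théorie inconditionnelle des motifs*, Publ. Math. IHÉS 83 (1996), §1.1–§1.2 (pp. 10–11: `ᶜΛ`, `*_L`, `*_H`,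
  the `𝔰𝔩₂`-triplet `(ᶜΛ, h, −L)`, "l'élément `(0 1 ; −1 0)` de `SL₂`").
* [GohbergLancasterRodman2006] I. Gohberg, P. Lancaster, L. Rodman, *Invariant Subspaces of Matrices with Applications*, SIAM Classics 51, Prop.
  9.5.1 (p0275), Lemma 9.5.2 (p0276), Thm. 9.6.1 (p0278).
* [Lange2023AbelianVarietiesComplex] H. Lange, *Abelian Varieties over the Complex Numbers*, §7.3.2 (p. 338: the primitive decomposition of `⋀W`).
* [Beauville2010SL2] A. Beauville, *The action of SL₂ on abelian varieties*, §5 ("the primitive elements are exactly the lowest weight elements").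
* [Kaplansky1954] I. Kaplansky, *Infinite Abelian Groups*, §18 Theorem 25 (p0065).

## Main statements (`L := LinearMap.mul K (ExteriorAlgebra K W) ω`, `Λ := lefschetzDual ω g`, `0 < g`; "`Λ`-hyperinvariant" is
`∀ T, Commute Λ T → ∀ x ∈ U, T x ∈ U`)
* ★★ `IsSymplectic.hyperinvariant_lefschetzDual_map_weylStar_iff` (`w(U)` is `Λ`-hyperinvariant iff `U` is `L`-hyperinvariant), ★★★
  **`IsSymplectic.hyperinvariant_lefschetzDual_iff_exists`** (the `Λ`-hyperinvariant subspaces are the bottom staircases `⊕_{k≤g} ⊕_{i+j_k ≤ k} ωⁱ ∧ P^{g−k}`),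
  ★★ **`IsSymplectic.ncard_setOf_hyperinvariant_lefschetzDual`** (there are `2^{g+1}` of them), ★★ `IsSymplectic.ker_lefschetzDual_pow_eq_biSup` (`Ker Λᵃ =
  ⊕_{k≤g} ⊕_{i+(k+1−a) ≤ k} ωⁱ ∧ P^{g−k}`), ★★ `IsSymplectic.range_lefschetzDual_pow_eq_biSup` (`Im Λᵇ = ⊕_{k≤g} ⊕_{i+b ≤ k} ωⁱ ∧ P^{g−k}`), ★★★
  **`IsSymplectic.primitiveSpace_neg_lefschetzDual_eq`** (the `Λ`-primitives of type `k ≤ g` are `ωᵏ ∧ P^{g−k}`), ★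
  `IsSymplectic.primitiveSpace_neg_lefschetzDual_eq_exteriorPower_inf_ker` (`= ⋀^{g+k}W ∩ Ker L`).
-/

namespace Literature.AlgebraicGeometry.Motives

namespace ExteriorLefschetz

open ExteriorAlgebra Literature.Algebra.Lie Module Set
open Literature.Algebra.Lie.HasLefschetzProperty (primitiveSpace mem_primitiveSpace_iff)

universe u v

variable {K : Type u} [Field K] [CharZero K] {W : Type v} [AddCommGroup W] [Module K W] {ω : ExteriorAlgebra K W} {g : ℕ}

/-- The bottom staircases of the Lefschetz module `⋀W` in the language of primitive forms: `⊕_k ⊕_{i + j_k ≤ k} Lⁱ P_{−k} = ⊕_{k ≤ g} ⊕_{i + j_k ≤ k}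
ωⁱ ∧ P^{g−k}` (the string types of `⋀W` are `0, …, g`). [folklore] -/
private theorem iSup_map_pow_primitiveSpace_eq_biSup (ω : ExteriorAlgebra K W) (g : ℕ) (j : ℕ → ℕ) :
    (⨆ k : ℕ, ⨆ i : ℕ, ⨆ (_ : i + j k ≤ k),
        (primitiveSpace (shiftedDegree K (fun i : ℕ ↦ ⋀[K]^i W) g) (LinearMap.mul K (ExteriorAlgebra K W) ω) k).map
          (LinearMap.mul K (ExteriorAlgebra K W) ω ^ i)) =
      ⨆ k : ℕ, ⨆ (_ : k ≤ g), ⨆ i : ℕ, ⨆ (_ : i + j k ≤ k), (primitive ω g (g - k)).map (LinearMap.mul K (ExteriorAlgebra K W) (ω ^ i)) := by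
  apply le_antisymm
  · refine iSup_le fun k ↦ iSup_le fun i ↦ iSup_le fun hi ↦ ?_
    rcases le_or_gt k g with hk | hk
    · rw [primitiveSpace_shiftedDegree_mul_eq_primitive ω g hk, mul_pow_eq_mul_pow ω]
      exact le_iSup_of_le k (le_iSup_of_le hk (le_iSup_of_le i (le_iSup_of_le hi le_rfl)))
    · rw [primitiveSpace_shiftedDegree_mul_eq_bot ω g hk, Submodule.map_bot]
      exact bot_le
  · refine iSup_le fun k ↦ iSup_le fun hk ↦ iSup_le fun i ↦ iSup_le fun hi ↦ ?_
    rw [← primitiveSpace_shiftedDegree_mul_eq_primitive ω g hk, ← mul_pow_eq_mul_pow ω]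
    exact le_iSup_of_le k (le_iSup_of_le i (le_iSup_of_le hi le_rfl))

/-- **`w(U)` is `Λ`-hyperinvariant iff `U` is `L`-hyperinvariant** (`w = weylStar ω g`, André's `(0 1 ; −1 0)`: `w L w⁻¹ = −Λ`). [cite: Andre1996Motifs,
§1.2 (p. 11)] [cite: GohbergLancasterRodman2006, §9.4 (p0273)] -/
theorem IsSymplectic.hyperinvariant_lefschetzDual_map_weylStar_iff (hω : IsSymplectic ω g) (hg : 0 < g) (U : Submodule K (ExteriorAlgebra K W)) :
    (∀ T : Module.End K (ExteriorAlgebra K W), Commute (lefschetzDual ω g) T → ∀ x ∈ U.map (weylStar ω g), T x ∈ U.map (weylStar ω g)) ↔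
      ∀ T : Module.End K (ExteriorAlgebra K W), Commute (LinearMap.mul K (ExteriorAlgebra K W) ω) T → ∀ x ∈ U, T x ∈ U := by
  haveI := hω.finiteDimensional_exteriorAlgebra
  rw [hω.weylStar_eq, ← hω.dual_eq_lefschetzDual hg]
  exact hω.hasLefschetzProperty_mul.hyperinvariant_dual_map_weylOperator_iff (isZGrading_shiftedDegree K (fun i : ℕ ↦ ⋀[K]^i W) g) U

/-- **THE `Λ`-HYPERINVARIANT SUBSPACES OF `⋀W` ARE THE BOTTOM STAIRCASES `⊕_{k ≤ g} ⊕_{i + j_k ≤ k} ωⁱ ∧ P^{g−k}`**, `j` normalised (`j_k ≤ k + 1`) and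
admissible (`j_k ≤ j_{k'} ≤ j_k + (k' − k)` for `k ≤ k' ≤ g`): a subspace stable under every operator commuting with the contraction `Λ` keeps, on each
string `p, ω ∧ p, …, ωᵏ ∧ p` (`p` a primitive `(g−k)`-form), a BOTTOM segment. [cite: GohbergLancasterRodman2006, Lemma 9.5.2 (p0276)] [cite: Andre1996Motifs,
§1.2 (p. 11)] [cite: Lange2023AbelianVarietiesComplex, §7.3.2 (p. 338)] -/
theorem IsSymplectic.hyperinvariant_lefschetzDual_iff_exists (hω : IsSymplectic ω g) (hg : 0 < g) (U : Submodule K (ExteriorAlgebra K W)) :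
    (∀ T : Module.End K (ExteriorAlgebra K W), Commute (lefschetzDual ω g) T → ∀ x ∈ U, T x ∈ U) ↔
      ∃ j : ℕ → ℕ, (∀ k, j k ≤ k + 1) ∧ (∀ k k' : ℕ, k ≤ k' → k ≤ g → k' ≤ g → j k ≤ j k' ∧ j k' ≤ j k + (k' - k)) ∧
        U = ⨆ k : ℕ, ⨆ (_ : k ≤ g), ⨆ i : ℕ, ⨆ (_ : i + j k ≤ k), (primitive ω g (g - k)).map (LinearMap.mul K (ExteriorAlgebra K W) (ω ^ i)) := by
  haveI := hω.finiteDimensional_exteriorAlgebra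
  rw [← hω.dual_eq_lefschetzDual hg, hω.hasLefschetzProperty_mul.hyperinvariant_dual_iff_exists (isZGrading_shiftedDegree K (fun i : ℕ ↦ ⋀[K]^i W) g)]
  simp only [hω.primitiveSpace_ne_bot_iff, iSup_map_pow_primitiveSpace_eq_biSup ω g]

/-- **`⋀W` HAS EXACTLY `2^{g+1}` `Λ`-HYPERINVARIANT SUBSPACES** (as many as `L`-hyperinvariant ones: `U ↦ w(U)` is a bijection). [cite:
GohbergLancasterRodman2006, Thm. 9.6.1 (p0278)] [cite: Andre1996Motifs, §1.2 (p. 11)] -/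
theorem IsSymplectic.ncard_setOf_hyperinvariant_lefschetzDual (hω : IsSymplectic ω g) (hg : 0 < g) :
    Set.ncard {U : Submodule K (ExteriorAlgebra K W) | ∀ T : Module.End K (ExteriorAlgebra K W),
      Commute (lefschetzDual ω g) T → ∀ x ∈ U, T x ∈ U} = 2 ^ (g + 1) := by
  haveI := hω.finiteDimensional_exteriorAlgebra
  rw [← hω.dual_eq_lefschetzDual hg, hω.hasLefschetzProperty_mul.ncard_setOf_hyperinvariant_dual (isZGrading_shiftedDegree K (fun i : ℕ ↦ ⋀[K]^i W) g),
    hω.ncard_setOf_hyperinvariant]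

/-- **`Ker Λᵃ = ⊕_{k ≤ g} ⊕_{i + (k+1−a) ≤ k} ωⁱ ∧ P^{g−k}`** — the bottom `a` positions of every string (`a = 1`: `Ker Λ = ⊕_j Pʲ`, the primitive forms).
[cite: Lange2023AbelianVarietiesComplex, §7.3.2 (p. 338)] [cite: Beauville2010SL2, §5] [cite: GohbergLancasterRodman2006, (9.5.7) (p0278)] -/
theorem IsSymplectic.ker_lefschetzDual_pow_eq_biSup (hω : IsSymplectic ω g) (hg : 0 < g) (a : ℕ) :
    LinearMap.ker (lefschetzDual ω g ^ a) =
      ⨆ k : ℕ, ⨆ (_ : k ≤ g), ⨆ i : ℕ, ⨆ (_ : i + (k + 1 - a) ≤ k), (primitive ω g (g - k)).map (LinearMap.mul K (ExteriorAlgebra K W) (ω ^ i)) := by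
  haveI := hω.finiteDimensional_exteriorAlgebra
  rw [← hω.dual_eq_lefschetzDual hg, hω.hasLefschetzProperty_mul.ker_dual_pow_eq_iSup (isZGrading_shiftedDegree K (fun i : ℕ ↦ ⋀[K]^i W) g),
    iSup_map_pow_primitiveSpace_eq_biSup ω g (fun k ↦ k + 1 - a)]

/-- **`Im Λᵇ = ⊕_{k ≤ g} ⊕_{i + b ≤ k} ωⁱ ∧ P^{g−k}`** — all but the top `b` positions of every string. [cite: Lange2023AbelianVarietiesComplex, §7.3.2 (p. 338)]
[cite: GohbergLancasterRodman2006, (9.5.7) (p0278)] -/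
theorem IsSymplectic.range_lefschetzDual_pow_eq_biSup (hω : IsSymplectic ω g) (hg : 0 < g) (b : ℕ) :
    LinearMap.range (lefschetzDual ω g ^ b) =
      ⨆ k : ℕ, ⨆ (_ : k ≤ g), ⨆ i : ℕ, ⨆ (_ : i + b ≤ k), (primitive ω g (g - k)).map (LinearMap.mul K (ExteriorAlgebra K W) (ω ^ i)) := by
  haveI := hω.finiteDimensional_exteriorAlgebra
  rw [← hω.dual_eq_lefschetzDual hg, hω.hasLefschetzProperty_mul.range_dual_pow_eq_iSup (isZGrading_shiftedDegree K (fun i : ℕ ↦ ⋀[K]^i W) g),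
    iSup_map_pow_primitiveSpace_eq_biSup ω g (fun _ ↦ b)]

/-- **THE `Λ`-PRIMITIVE (COPRIMITIVE) FORMS OF TYPE `k` ARE `ωᵏ ∧ P^{g−k}`**: for the reversed Lefschetz pair `(−H, Λ)` on `⋀W` the primitive subspace
of type `k ≤ g` — the forms of `(−H)`-weight `−k` (wedge degree `g + k`) killed by `Λ^{k+1}` — is the top layer `ωᵏ ∧ P^{g−k}` of the strings of
length `k + 1`. [cite: Andre1996Motifs, §1.2 (p. 11: the triplet (ᶜΛ, h, −L))] [cite: Lange2023AbelianVarietiesComplex, §7.3.2 (p. 338)] [cite: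
Beauville2010SL2, §5] -/
theorem IsSymplectic.primitiveSpace_neg_lefschetzDual_eq (hω : IsSymplectic ω g) (hg : 0 < g) {k : ℕ} (hk : k ≤ g) :
    primitiveSpace (-shiftedDegree K (fun i : ℕ ↦ ⋀[K]^i W) g) (lefschetzDual ω g) k =
      (primitive ω g (g - k)).map (LinearMap.mul K (ExteriorAlgebra K W) (ω ^ k)) := by
  haveI := hω.finiteDimensional_exteriorAlgebra
  rw [← hω.dual_eq_lefschetzDual hg, hω.hasLefschetzProperty_mul.primitiveSpace_neg_dual_eq_map_pow (isZGrading_shiftedDegree K (fun i : ℕ ↦ ⋀[K]^i W) g),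
    primitiveSpace_shiftedDegree_mul_eq_primitive ω g hk, mul_pow_eq_mul_pow ω]

/-- **`ωᵏ ∧ P^{g−k} = ⋀^{g+k}W ∩ Ker L`**: the `Λ`-primitive forms of type `k` are the `(g+k)`-forms killed by `ω ∧ ·` (the highest weight vectors of
weight `k`). [cite: Lange2023AbelianVarietiesComplex, §7.3.2 (p. 338)] [cite: Beauville2010SL2, §5] -/
theorem IsSymplectic.primitiveSpace_neg_lefschetzDual_eq_exteriorPower_inf_ker (hω : IsSymplectic ω g) (hg : 0 < g) (k : ℕ) :
    primitiveSpace (-shiftedDegree K (fun i : ℕ ↦ ⋀[K]^i W) g) (lefschetzDual ω g) k =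
      ⋀[K]^(g + k) W ⊓ LinearMap.ker (LinearMap.mul K (ExteriorAlgebra K W) ω) := by
  haveI := hω.finiteDimensional_exteriorAlgebra
  rw [← hω.dual_eq_lefschetzDual hg,
    hω.hasLefschetzProperty_mul.primitiveSpace_neg_dual_eq_degreeSpace_inf_ker (isZGrading_shiftedDegree K (fun i : ℕ ↦ ⋀[K]^i W) g),
    degreeSpace_shiftedDegree_eq_exteriorPower g (k : ℤ) (g + k) (by omega)]

end ExteriorLefschetz

end Literature.AlgebraicGeometry.Motives
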